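import Summits.ValiantsHypothesis.ValiantsHypothesis.Theorems.BarrierLeverAnchoredDoorHitsLowerPairsStarTwoCentreDesignDet

/-!
# Route BarrierLever — support item `AnchoredDoorHitsLowerPairs` (stmt-ValiantsHypothesis-22510), line `anchored_peeling`:
# EXCESS-ONE PAIRS, I: positivity of design entries, prescribed seatings, swap symmetry, the frame

Helper file (`--supports stmt-ValiantsHypothesis-22510`; val-np-p1 g34), preliminaries of …StarExcessOne (every injective lower pair
with `r = n₁ + n₂ + 2` is STAR-GOOD). Closes NO item; nothing here bears on crux 14610 or on `VP ≠ VNP`, which is NOT proved.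

CONTENT. (§1) At 0/1 (more generally nonnegative integer) weights every two-centre summand is `≥ 0`, so ONE top-degree summand `≥ 1`
makes the entry `≥ 1` (`one_le_twoTop_of_term`); the double-star summand and the «all centres on one side» summands in closed form.
(§2) Bijections between finite types with one / two prescribed values; the swap symmetry of star-goodness (`starEntry_swap`).
(§3) The frame of an excess-one pair (`#big row faces = n₂ + 1`, `#big column faces = n₁ + 1`; indices of subfaces; maximum faces are
up-closed) and the SINGLETON DESIGN THEOREM `starDet_ne_zero_of_singleton_design`: a design with `𝓐* = {A*}`, `𝓢* = {S*}` and
`twoTop ≥ 1` on `(A*, S*)` makes the pair star-good (…StarTwoCentreDesignDet). (§4) Seating lemmas.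
-/

set_option linter.dupNamespace false

namespace Summit.ValiantsHypothesis.ValiantsHypothesis.Theorems.BarrierLever.AnchoredPeeling

open Finset

noncomputable section

namespace StarDoor

variable {h : ℕ}

/-! ## 1. Positivity of integer two-centre entries at 0/1 weights -/

section Positivity

variable (gb db : Fin h → Fin h → ℤ)

/-- Summands are nonnegative for nonnegative weights. -/
theorem scCoef_nonneg (hg : ∀ b e, 0 ≤ gb b e) (hd : ∀ b e, 0 ≤ db b e) (A S A' S' : Finset (Fin h)) :
    0 ≤ scCoef gb db A S A' S' := by
  unfold scCoef
  exact mul_nonneg (Finset.prod_nonneg fun b _ => Finset.sum_nonneg fun e _ => hg b e)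
    (Finset.prod_nonneg fun e _ => Finset.sum_nonneg fun b _ => hd b e)

/-- **A top-degree summand `≥ 1` makes the two-centre entry `≥ 1`** (nonnegative weights). -/
theorem one_le_twoTop_of_term (hg : ∀ b e, 0 ≤ gb b e) (hd : ∀ b e, 0 ≤ db b e) {A S A' S' : Finset (Fin h)}
    (hA' : A' ⊆ A) (hS' : S' ⊆ S) (hdeg : scDeg A S A' S' = tcPot A S) (hpos : 1 ≤ scCoef gb db A S A' S') :
    1 ≤ twoTop gb db A S := by
  classical
  unfold twoTop
  have h1 : scCoef gb db A S A' S' ≤ ∑ S'' ∈ S.powerset,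
      (if scDeg A S A' S'' = tcPot A S then scCoef gb db A S A' S'' else 0) := by
    rw [← Finset.sum_erase_add _ _ (Finset.mem_powerset.mpr hS'), if_pos hdeg]
    have : 0 ≤ ∑ x ∈ (S.powerset).erase S', (if scDeg A S A' x = tcPot A S then scCoef gb db A S A' x else 0) :=
      Finset.sum_nonneg fun x _ => by split_ifs; exacts [scCoef_nonneg gb db hg hd _ _ _ _, le_refl _]
    linarith
  have h2 : (∑ S'' ∈ S.powerset, (if scDeg A S A' S'' = tcPot A S then scCoef gb db A S A' S'' else 0)) ≤
      ∑ A'' ∈ A.powerset, ∑ S'' ∈ S.powerset,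
        (if scDeg A S A'' S'' = tcPot A S then scCoef gb db A S A'' S'' else 0) := by
    rw [← Finset.sum_erase_add _ _ (Finset.mem_powerset.mpr hA')]
    have : 0 ≤ ∑ x ∈ (A.powerset).erase A', ∑ S'' ∈ S.powerset,
        (if scDeg A S x S'' = tcPot A S then scCoef gb db A S x S'' else 0) :=
      Finset.sum_nonneg fun x _ => Finset.sum_nonneg fun y _ => by
        split_ifs; exacts [scCoef_nonneg gb db hg hd _ _ _ _, le_refl _]
    linarith
  linarith

/-- The double-star summand `({b₀}, {e₀})`: `∏_{b ∈ A ∖ b₀} ḡ_{b e₀} · ∏_{e ∈ S ∖ e₀} d̄_{b₀ e}`. -/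
theorem scCoef_doubleStar (A S : Finset (Fin h)) (b₀ e₀ : Fin h) :
    scCoef gb db A S {b₀} {e₀} = (∏ b ∈ A \ {b₀}, gb b e₀) * ∏ e ∈ S \ {e₀}, db b₀ e := by
  unfold scCoef; simp

/-- The summand «all column vertices are centres» `(∅, S)`: `∏_{b ∈ A} Σ_{e ∈ S} ḡ_{be}`. -/
theorem scCoef_allCols (A S : Finset (Fin h)) : scCoef gb db A S ∅ S = ∏ b ∈ A, ∑ e ∈ S, gb b e := by
  unfold scCoef; simp

end Positivity

/-! ## 2. Bijections with prescribed values; the swap symmetry -/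

/-- A bijection between finite types of equal size with ONE prescribed value. -/
theorem exists_equiv_apply_eq {X Y : Type*} [Fintype X] [Fintype Y] [DecidableEq Y] (hc : Fintype.card X = Fintype.card Y)
    (x : X) (y : Y) : ∃ e : X ≃ Y, e x = y := by
  classical
  let e₀ : X ≃ Y := Fintype.equivOfCardEq hc
  exact ⟨e₀.trans (Equiv.swap (e₀ x) y), by simp⟩

/-- A bijection between finite types of equal size with TWO prescribed values. -/
theorem exists_equiv_apply_eq₂ {X Y : Type*} [Fintype X] [Fintype Y] [DecidableEq X] [DecidableEq Y]
    (hc : Fintype.card X = Fintype.card Y) {x₁ x₂ : X} {y₁ y₂ : Y} (hx : x₁ ≠ x₂) (hy : y₁ ≠ y₂) :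
    ∃ e : X ≃ Y, e x₁ = y₁ ∧ e x₂ = y₂ := by
  classical
  obtain ⟨e₁, he₁⟩ := exists_equiv_apply_eq hc x₁ y₁
  refine ⟨e₁.trans (Equiv.swap (e₁ x₂) y₂), ?_, by simp⟩
  have hne : e₁ x₁ ≠ e₁ x₂ := fun h' => hx (e₁.injective h')
  simp only [Equiv.trans_apply]
  rw [Equiv.swap_apply_of_ne_of_ne hne (he₁ ▸ hy), he₁]

variable {r : ℕ}

/-- **Swap symmetry of star-goodness** (`starEntry_swap`). -/
theorem starGood_swap (u w : Fin r → Finset (Fin h))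
    (H : ∃ g d : Fin h → Fin h → ℂ, (Matrix.of fun i j : Fin r => starEntry g d (w i) (u j)).det ≠ 0) :
    ∃ g d : Fin h → Fin h → ℂ, (Matrix.of fun i j : Fin r => starEntry g d (u i) (w j)).det ≠ 0 := by
  obtain ⟨g, d, hdet⟩ := H
  refine ⟨fun e b => d b e, fun e b => g b e, ?_⟩
  have : (Matrix.of fun i j : Fin r => starEntry (fun e b => d b e) (fun e b => g b e) (u i) (w j)) =
      (Matrix.of fun i j : Fin r => starEntry g d (w i) (u j)).transpose := by
    ext i j; simp only [Matrix.of_apply, Matrix.transpose_apply]; rw [starEntry_swap]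
  rw [this, Matrix.det_transpose]; exact hdet

/-! ## 3. Excess-one pairs: the common data -/

section ExcessOne

variable (u w : Fin r → Finset (Fin h))

/-- The counting hypothesis `r = n₁ + n₂ + 2` gives `#big row faces = n₂ + 1` and `#big column faces = n₁ + 1`. -/
theorem bigs_of_excessOne (hu : Function.Injective u) (hw : Function.Injective w)
    (hlu : IsLowerSet (Set.range u)) (hlw : IsLowerSet (Set.range w)) (hr : 0 < r)
    (hε : r = (univ.filter fun i => (u i).card = 1).card + (univ.filter fun j => (w j).card = 1).card + 2) :
    (univ.filter fun i => 2 ≤ (u i).card).card = (univ.filter fun j => (w j).card = 1).card + 1 ∧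
      (univ.filter fun j => 2 ≤ (w j).card).card = (univ.filter fun i => (u i).card = 1).card + 1 := by
  have hcu := card_classes u
  have hcw := card_classes w
  have hZr := card_filter_empty_eq_one u hu hlu hr
  have hZc := card_filter_empty_eq_one w hw hlw hr
  omega

/-- A lower family contains every subface of its faces, as some enumerated face. -/
theorem exists_index_of_subset {v : Fin r → Finset (Fin h)} (hlv : IsLowerSet (Set.range v)) {i : Fin r} {B : Finset (Fin h)}
    (hB : B ⊆ v i) : ∃ i', v i' = B := by
  obtain ⟨i', hi'⟩ : B ∈ Set.range v := hlv (show B ≤ v i from hB) ⟨i, rfl⟩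
  exact ⟨i', hi'⟩

/-- A big face of maximum size is up-closed: it is contained in no other face. -/
theorem eq_of_max_card {v : Fin r → Finset (Fin h)} (hv : Function.Injective v) {i : Fin r}
    (hmax : ∀ i', 2 ≤ (v i').card → (v i').card ≤ (v i).card) (hbig : 2 ≤ (v i).card) {i' : Fin r} (hsub : v i ⊆ v i') :
    i' = i := by
  have hle : (v i).card ≤ (v i').card := Finset.card_le_card hsub
  have hge := hmax i' (le_trans hbig hle)
  exact hv (Finset.eq_of_subset_of_card_le hsub hge).symm

/-- **The design theorem specialised to `𝓐* = {A*}`, `𝓢* = {S*}`:** given the seatings and `twoTop ≥ 1` on `(A*, S*)`, star-good. -/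
theorem starDet_ne_zero_of_singleton_design (hu : Function.Injective u) (hw : Function.Injective w)
    (hlu : IsLowerSet (Set.range u)) (hlw : IsLowerSet (Set.range w)) (hr : 0 < r)
    {is js : Fin r} (hbi : 2 ≤ (u is).card) (hbj : 2 ≤ (w js).card)
    (hmi : ∀ i', 2 ≤ (u i').card → (u i').card ≤ (u is).card) (hmj : ∀ j', 2 ≤ (w j').card → (w j').card ≤ (w js).card)
    (α : {j : Fin r // (w j).card = 1} ≃ {i : Fin r // 2 ≤ (u i).card ∧ i ∉ ({is} : Finset (Fin r))})
    (β : {i : Fin r // (u i).card = 1} ≃ {j : Fin r // 2 ≤ (w j).card ∧ j ∉ ({js} : Finset (Fin r))})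
    (hpos : 1 ≤ twoTop (seatG u w (fun j => (α j).1) ℤ) (seatD u w (fun i => (β i).1) ℤ) (u is) (w js)) :
    ∃ g d : Fin h → Fin h → ℂ, (Matrix.of fun i j : Fin r => starEntry g d (u i) (w j)).det ≠ 0 := by
  classical
  let γ : {i : Fin r // i ∈ ({is} : Finset (Fin r))} ≃ {j : Fin r // j ∈ ({js} : Finset (Fin r))} :=
    { toFun := fun _ => ⟨js, Finset.mem_singleton_self js⟩
      invFun := fun _ => ⟨is, Finset.mem_singleton_self is⟩
      left_inv := fun x => Subtype.ext (Finset.mem_singleton.mp x.2).symm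
      right_inv := fun y => Subtype.ext (Finset.mem_singleton.mp y.2).symm }
  let D : TCDesign u w :=
    { Astar := {is}, Sstar := {js}
      big_A := fun i hi => by rw [Finset.mem_singleton.mp hi]; exact hbi
      big_S := fun j hj => by rw [Finset.mem_singleton.mp hj]; exact hbj
      up_A := fun i hi i' hsub => by
        rw [Finset.mem_singleton.mp hi] at hsub
        rw [Finset.mem_singleton]; exact eq_of_max_card hu hmi hbi hsub
      up_S := fun j hj j' hsub => by
        rw [Finset.mem_singleton.mp hj] at hsub
        rw [Finset.mem_singleton]; exact eq_of_max_card hw hmj hbj hsub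
      α := α, β := β, γ := γ
      hZr := card_filter_empty_eq_one u hu hlu hr
      hZc := card_filter_empty_eq_one w hw hlw hr }
  refine D.starDet_ne_zero_of_design hu hw ?_
  haveI : Subsingleton {i : Fin r // i ∈ ({is} : Finset (Fin r))} :=
    ⟨fun x y => Subtype.ext ((Finset.mem_singleton.mp x.2).trans (Finset.mem_singleton.mp y.2).symm)⟩
  rw [Matrix.det_eq_elem_of_subsingleton _ ⟨is, Finset.mem_singleton_self is⟩]
  have h1 : 1 ≤ twoTop (D.gD ℤ) (D.dD ℤ) (u is) (w js) := hpos
  change twoTop (D.gD ℤ) (D.dD ℤ) (u is) (w js) ≠ 0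
  omega

/-! ## 4. Seating lemmas -/

/-- Seating weights are `0/1`, hence nonnegative. -/
theorem seatG_nonneg (αf : {j : Fin r // (w j).card = 1} → Fin r) (b e : Fin h) : 0 ≤ seatG u w αf ℤ b e := by
  unfold seatG; split_ifs <;> norm_num

/-- Seating weights are `0/1`, hence nonnegative. -/
theorem seatD_nonneg (βf : {i : Fin r // (u i).card = 1} → Fin r) (b e : Fin h) : 0 ≤ seatD u w βf ℤ b e := by
  unfold seatD; split_ifs <;> norm_num

/-- A seated vertex sees the vertices of its face. -/
theorem seatG_eq_one (αf : {j : Fin r // (w j).card = 1} → Fin r) (j : {j : Fin r // (w j).card = 1}) {e b : Fin h}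
    (he : w j.1 = {e}) (hb : b ∈ u (αf j)) : seatG u w αf ℤ b e = 1 := by
  unfold seatG; rw [if_pos ⟨j, he, hb⟩]

/-- A seated vertex sees the vertices of its face. -/
theorem seatD_eq_one (βf : {i : Fin r // (u i).card = 1} → Fin r) (i : {i : Fin r // (u i).card = 1}) {b e : Fin h}
    (hb : u i.1 = {b}) (he : e ∈ w (βf i)) : seatD u w βf ℤ b e = 1 := by
  unfold seatD; rw [if_pos ⟨i, hb, he⟩]

/-- The summand «all row vertices are centres» `(A, ∅)`: `∏_{e ∈ S} Σ_{b ∈ A} d̄_{be}`. -/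
theorem scCoef_allRows (gb db : Fin h → Fin h → ℤ) (A S : Finset (Fin h)) : scCoef gb db A S A ∅ = ∏ e ∈ S, ∑ b ∈ A, db b e := by
  unfold scCoef; simp

/-- A product of integers each `≥ 1` is `≥ 1`. -/
theorem one_le_prod_int {ι : Type*} (s : Finset ι) (f : ι → ℤ) (hf : ∀ x ∈ s, 1 ≤ f x) : 1 ≤ ∏ x ∈ s, f x :=
  Finset.prod_induction f (fun z => 1 ≤ z) (fun _ _ ha hb => one_le_mul_of_one_le_of_one_le ha hb) (le_refl 1) hf

/-- The number of seats equals the number of vertices on the other side (row version). -/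
theorem card_seats (v v' : Fin r → Finset (Fin h)) {is : Fin r} (hbig : 2 ≤ (v is).card)
    (hp : (univ.filter fun i => 2 ≤ (v i).card).card = (univ.filter fun j => (v' j).card = 1).card + 1) :
    Fintype.card {j : Fin r // (v' j).card = 1} = Fintype.card {i : Fin r // 2 ≤ (v i).card ∧ i ∉ ({is} : Finset (Fin r))} := by
  classical
  rw [Fintype.card_subtype, Fintype.card_subtype]
  have : (univ.filter fun i => 2 ≤ (v i).card ∧ i ∉ ({is} : Finset (Fin r))) = (univ.filter fun i => 2 ≤ (v i).card).erase is := by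
    ext i; simp [Finset.mem_erase, and_comm]
  rw [this, Finset.card_erase_of_mem (by simp [hbig])]
  omega

end ExcessOne

end StarDoor

end

end Summit.ValiantsHypothesis.ValiantsHypothesis.Theorems.BarrierLever.AnchoredPeeling
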